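import Summits.CriticalPhenomena.PercolationContinuityZ3.Theorems.PercNearOneGluingNoHeavyLowerTailFKPhiMassDefs
import Summits.CriticalPhenomena.PercolationContinuityZ3.Theorems.PercNearOneGluingNoHeavyLowerTailFKHullPortTASections
import HarnessLib

/-!
# FK sub-lane: one-pair sections of the `Φ`-masses at `Y` (deletion / contraction), invariance under `Y–K` pairs, absorption

Support file (`--supports stmt-CriticalPhenomena-4575`), FK sub-lane `prim-bschramm-fk-2` (gen 4); builds on p205010 (kernel theorem,
internal audit signed; external expert review pending).  No definitions, no named facts, no sorries; standard axioms.

The KEY OBSERVATION of fk-2 gen 4's proof of Lemma Φ(b)_FK (`FK.PhiFKMonotone`, bschramm/FK-Q2.md §13): a pair `f = s(y₀, v)` with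
`y₀ ∈ Y` lies in the cut set `cut Y ω` of EVERY configuration, so the integrand `FK.phiD` (world mean in `G − cut_Y(ω)` minus own
value) does not see `w f`; hence, exactly as in gen 3's hull-port sections (`…FKHullPortTASections.lean`, `FK.rcWeightW_affine`),
* `FK.zMass_section`, `FK.phiMass_section` — `M(w) = (1 − w f)·M(w[f↦0]) + (w f)·M(w[f↦1])` for `M ∈ {zMass, phiMass}` and `f` not
  meeting the deleted set `K` (deletion and contraction endpoints; contraction = parameter `1`);
* `FK.zMass_update_of_mem`, `FK.phiMass_update_of_mem`, `FK.zMass_delW_of_subset`, `FK.phiMass_delW_of_subset` — pairs meeting both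
  `Y` and `K` are invisible (deleted in `G − K̄` and in every world);
* `FK.phiMass_absorb` — if `s(y₀, v)` has parameter `1`, adding `v` to `Y` changes nothing (the wired hull of `Y`).
[cite: Grimmett2006, §1.4 eq. (1.20) (p. 15); Thm. (3.1)(a) (p. 37)] [cite: VandenbergHaggstromKahn2005, §2.1 Lemma 2.3 (p. 10)]
-/

noncomputable section

namespace Summit.CriticalPhenomena.PercolationContinuityZ3.Theorems.FK

open MeasureTheory Set Literature.Probability.LatticeModels Literature.Probability.Percolation
open Literature.Probability.Percolation.DecisionTree (ind ind_of_mem ind_of_not_mem ind_nonneg)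
open Literature.Probability.Percolation.BHK2006 (rcMass rcMass_nonneg delW)
open Summit.CriticalPhenomena.PercolationContinuityZ3.Theorems.HullPort (cut avoidEv edge_mem_cut cut_insert_edge
  insert_mem_avoidEv_iff)
open scoped Classical

variable {V : Type*} [Fintype V]

section DelW

omit [Fintype V]

/-- Deleting a set of pairs commutes with updating a pair outside it. [folklore] -/
theorem delW_update_of_not_mem (w : Sym2 V → unitInterval) {A : Set (Sym2 V)} {f : Sym2 V} (hf : f ∉ A)
    (c : unitInterval) : delW (Function.update w f c) A = Function.update (delW w A) f c := by
  funext e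
  by_cases he : e = f
  · subst he
    simp only [delW, if_neg hf, Function.update_self]
  · simp only [delW, Function.update_of_ne he]

/-- Deleting a set of pairs does not see an update inside it. [folklore] -/
theorem delW_update_of_mem (w : Sym2 V → unitInterval) {A : Set (Sym2 V)} {f : Sym2 V} (hf : f ∈ A)
    (c : unitInterval) : delW (Function.update w f c) A = delW w A := by
  funext e
  by_cases he : e = f
  · subst he
    simp only [delW, if_pos hf]
  · simp only [delW, Function.update_of_ne he]

/-- Deleting `P ⊆ A` and then `A` is deleting `A`. [folklore] -/
theorem delW_delW_of_subset (w : Sym2 V → unitInterval) {P A : Set (Sym2 V)} (h : P ⊆ A) :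
    delW (delW w P) A = delW w A := by
  funext e
  by_cases he : e ∈ A
  · simp only [delW, if_pos he]
  · simp only [delW, if_neg he, if_neg (fun hP => he (h hP))]

/-- The deleted weight vector agrees with `w` off the deleted set. [folklore] -/
theorem delW_eq_off (w : Sym2 V → unitInterval) (P : Set (Sym2 V)) : ∀ e ∉ P, delW w P e = w e := by
  intro e he
  simp only [delW, if_neg he]

/-- The pairs meeting `Y` lie in every cut set of `Y`. [folklore] -/
theorem edgesOf_subset_cut (Y : Set V) (ω : Set (Sym2 V)) : CSH.edgesOf Y ⊆ cut Y ω := by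
  rintro e ⟨u, hue, huY⟩
  exact ⟨u, hue, u, huY, SimpleGraph.Reachable.refl u⟩

end DelW

/-! ### `phiD` does not see the parameters of the pairs meeting the cluster of `Y` -/

/-- `phiD` does not see the parameters of the pairs in the cut set of `Y`. [cite: VandenbergHaggstromKahn2005, §2.1 Lemma 2.3 (p. 10)] -/
theorem phiD_congr_off {w w' : Sym2 V → unitInterval} (q : ℝ) (x : V) (Y : Set V) (g : Set (Sym2 V) → ℝ)
    {ω : Set (Sym2 V)} (h : ∀ e ∉ cut Y ω, w e = w' e) : phiD w q x Y g ω = phiD w' q x Y g ω := by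
  unfold phiD
  rw [wE_congr_off q h]

/-- Updating a pair at `Y` does not change `phiD`. [cite: VandenbergHaggstromKahn2005, §2.1 Lemma 2.3 (p. 10)] -/
theorem phiD_update_of_mem (w : Sym2 V → unitInterval) (q : ℝ) (x : V) {Y : Set V} {y₀ : V} (hy₀ : y₀ ∈ Y) (v : V)
    (c : unitInterval) (g : Set (Sym2 V) → ℝ) (ω : Set (Sym2 V)) :
    phiD (Function.update w s(y₀, v) c) q x Y g ω = phiD w q x Y g ω := by
  refine (phiD_congr_off q x Y g fun e he => ?_).symm
  have hne : e ≠ s(y₀, v) := fun hef => he (by rw [hef]; exact edge_mem_cut y₀ v Y hy₀ ω)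
  exact (Function.update_of_ne hne c w).symm

/-- Deleting pairs meeting `Y` does not change `phiD`. [cite: VandenbergHaggstromKahn2005, §2.1 Lemma 2.3 (p. 10)] -/
theorem phiD_delW_of_subset (w : Sym2 V → unitInterval) (q : ℝ) (x : V) {Y : Set V} {P : Set (Sym2 V)}
    (hP : P ⊆ CSH.edgesOf Y) (g : Set (Sym2 V) → ℝ) (ω : Set (Sym2 V)) :
    phiD (delW w P) q x Y g ω = phiD w q x Y g ω :=
  (phiD_congr_off q x Y g fun e he => (delW_eq_off w P e fun heP => he (edgesOf_subset_cut Y ω (hP heP))).symm).symm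

/-! ### One-pair sections (deletion / contraction endpoints) -/

/-- **Section of the partition function** along a pair `f` not meeting `K`:
`Z_{G−K̄}(w) = (1 − w f)·Z(w[f↦0]) + (w f)·Z(w[f↦1])`. [cite: Grimmett2006, Thm. (3.1)(a), eq. (1.20)] -/
theorem zMass_section (w : Sym2 V → unitInterval) (q : ℝ) {K : Set V} {f : Sym2 V} (hf : f ∉ CSH.edgesOf K) :
    zMass w q K = (1 - (w f : ℝ)) * zMass (Function.update w f 0) q K + (w f : ℝ) * zMass (Function.update w f 1) q K := by
  unfold zMass rcPartitionFunctionW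
  rw [delW_update_of_not_mem w hf, delW_update_of_not_mem w hf, Finset.mul_sum, Finset.mul_sum, ← Finset.sum_add_distrib]
  refine Finset.sum_congr rfl fun ω _ => ?_
  rw [rcWeightW_affine (delW w (CSH.edgesOf K)) q ∅ f ω]
  simp only [delW, if_neg hf]

/-- **Section of the `Φ`-mass** along a pair `f = s(y₀, v)` at `Y` not meeting `K`:
`phiMass(w) = (1 − w f)·phiMass(w[f↦0]) + (w f)·phiMass(w[f↦1])` — the integrand `phiD` does not see `w f`.
[cite: Grimmett2006, Thm. (3.1)(a), eq. (1.20)] [cite: VandenbergHaggstromKahn2005, §2.1 Lemma 2.3 (p. 10)] -/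
theorem phiMass_section (w : Sym2 V → unitInterval) (q : ℝ) (x : V) {Y : Set V} {y₀ : V} (hy₀ : y₀ ∈ Y) (v : V)
    (g : Set (Sym2 V) → ℝ) {K : Set V} (hf : s(y₀, v) ∉ CSH.edgesOf K) :
    phiMass w q x Y g K = (1 - (w s(y₀, v) : ℝ)) * phiMass (Function.update w s(y₀, v) 0) q x Y g K +
      (w s(y₀, v) : ℝ) * phiMass (Function.update w s(y₀, v) 1) q x Y g K := by
  unfold phiMass
  rw [delW_update_of_not_mem w hf, delW_update_of_not_mem w hf, Finset.mul_sum, Finset.mul_sum, ← Finset.sum_add_distrib]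
  refine Finset.sum_congr rfl fun ω _ => ?_
  rw [rcWeightW_affine (delW w (CSH.edgesOf K)) q ∅ s(y₀, v) ω, phiD_update_of_mem w q x hy₀ v 0 g ω,
    phiD_update_of_mem w q x hy₀ v 1 g ω]
  simp only [delW, if_neg hf]
  ring

/-! ### Invariance under the pairs between `Y` and `K` -/

/-- Deleting pairs of `K̄` does not change the partition function of `G − K̄`. [cite: Grimmett2006, eq. (1.20)] -/
theorem zMass_delW_of_subset (w : Sym2 V → unitInterval) (q : ℝ) {K : Set V} {P : Set (Sym2 V)} (hP : P ⊆ CSH.edgesOf K) :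
    zMass (delW w P) q K = zMass w q K := by
  unfold zMass; rw [delW_delW_of_subset w hP]

/-- Deleting pairs meeting both `Y` and `K` does not change the `Φ`-mass. [cite: VandenbergHaggstromKahn2005, §2.1 Lemma 2.3 (p. 10)] -/
theorem phiMass_delW_of_subset (w : Sym2 V → unitInterval) (q : ℝ) (x : V) {Y : Set V} (g : Set (Sym2 V) → ℝ) {K : Set V}
    {P : Set (Sym2 V)} (hPK : P ⊆ CSH.edgesOf K) (hPY : P ⊆ CSH.edgesOf Y) :
    phiMass (delW w P) q x Y g K = phiMass w q x Y g K := by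
  unfold phiMass
  rw [delW_delW_of_subset w hPK]
  exact Finset.sum_congr rfl fun ω _ => by rw [phiD_delW_of_subset w q x hPY g ω]

/-- Updating a pair meeting both `Y` and `K` does not change the partition function of `G − K̄`. [cite: Grimmett2006, eq. (1.20)] -/
theorem zMass_update_of_mem (w : Sym2 V → unitInterval) (q : ℝ) {K : Set V} {f : Sym2 V} (hf : f ∈ CSH.edgesOf K)
    (c : unitInterval) : zMass (Function.update w f c) q K = zMass w q K := by
  unfold zMass; rw [delW_update_of_mem w hf]

/-- Updating a pair at `Y` meeting `K` does not change the `Φ`-mass. [cite: VandenbergHaggstromKahn2005, §2.1 Lemma 2.3 (p. 10)] -/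
theorem phiMass_update_of_mem (w : Sym2 V → unitInterval) (q : ℝ) (x : V) {Y : Set V} {y₀ : V} (hy₀ : y₀ ∈ Y) (v : V)
    (g : Set (Sym2 V) → ℝ) {K : Set V} (hf : s(y₀, v) ∈ CSH.edgesOf K) (c : unitInterval) :
    phiMass (Function.update w s(y₀, v) c) q x Y g K = phiMass w q x Y g K := by
  unfold phiMass
  rw [delW_update_of_mem w hf]
  exact Finset.sum_congr rfl fun ω _ => by rw [phiD_update_of_mem w q x hy₀ v c g ω]

/-! ### Absorption: a weight-one pair at `Y` puts its far endpoint into `Y` -/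

/-- **Absorption**: if the pair `s(y₀, v)` (`y₀ ∈ Y`, not meeting `K`) has parameter `1`, adding `v` to `Y` does not change the
`Φ`-mass (configurations with the pair closed have weight `0`; with it open, the cut set and the avoidance event of `Y ∪ {v}` are those of `Y`).
[cite: Grimmett2006, §1.4 eq. (1.20) (p. 15)] -/
theorem phiMass_absorb (w : Sym2 V → unitInterval) (q : ℝ) (x : V) {Y : Set V} {y₀ : V} (hy₀ : y₀ ∈ Y) (v : V)
    (g : Set (Sym2 V) → ℝ) {K : Set V} (hf : s(y₀, v) ∉ CSH.edgesOf K) (h1 : (w s(y₀, v) : ℝ) = 1) :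
    phiMass w q x (insert v Y) g K = phiMass w q x Y g K := by
  unfold phiMass
  refine Finset.sum_congr rfl fun ω _ => ?_
  by_cases he : s(y₀, v) ∈ ω
  · have hω : insert s(y₀, v) ω = ω := Set.insert_eq_of_mem he
    have hcut : cut (insert v Y) ω = cut Y ω := by rw [← cut_insert_edge y₀ v Y hy₀ ω, hω]
    have hav : ind (avoidEv x (insert v Y)) ω = ind (avoidEv x Y) ω := by
      by_cases h : ω ∈ avoidEv x (insert v Y)
      · rw [ind_of_mem h, ind_of_mem (hω ▸ (insert_mem_avoidEv_iff x y₀ v Y hy₀ ω).2 h)]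
      · rw [ind_of_not_mem h, ind_of_not_mem fun h' => h ((insert_mem_avoidEv_iff x y₀ v Y hy₀ ω).1 (hω.symm ▸ h'))]
    unfold phiD
    rw [hcut, hav]
  · have h1' : ((delW w (CSH.edgesOf K) s(y₀, v) : unitInterval) : ℝ) = 1 := by
      simp only [delW, if_neg hf]; exact h1
    rw [rcWeightW_eq_zero_of_one_not_mem _ q ∅ h1' he, zero_mul, zero_mul]

end Summit.CriticalPhenomena.PercolationContinuityZ3.Theorems.FK

end
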